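import Summits.QuantumFields.GaugeBoot.WilsonLoopLimitMonotone

/-!
# Gauge-boot: the link-minor transfer for `W̄(R × T)` at infinite-volume limit points (zero-solve reading, kernel form)

Cell `pub-gaugeboot` (HOME `run/shared/lean/pub/pub-gaugeboot/`), numerics seat `pub-gaugeboot-num1` (gen 12).
Lane SKETCH offered to the lead / the Lean seats; it is the kernel form of the zero-solve reading of record
`HOME/pub-gaugeboot-num1/limit-batch2/TRANSFER-NOTE.md` (INBOX l.639, loop concurrence l.640): at every
infinite-volume limit point `μ` of the `SU(N)` torus Wilson states along EVEN tori (coupling `β/N ≥ 0`),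

* `∫ W̄(n × m) dμ = ∫ W̄(m × n) dμ` (axis exchange; limit of the torus identity `wilsonExpectation_wilsonLoop_comm`);
* `(∫ W̄((t+1) × m) dμ)² ≤ (∫ W̄(t × m) dμ) · (∫ W̄(s × (t+2)) dμ)` for every `s ≤ m`
  (the `2 × 2` Hankel minor on the line `m` — `wilsonLoop_integral_limit_hankel` —, the axis exchange
  `W̄((t+2) × m) = W̄(m × (t+2))`, and antitonicity on the line `t+2` — `antitone_wilsonLoop_integral_limit`);
* hence two certified UPPER windows, `b₁` on `W̄(t × m)` and `b₂` on `W̄(s × (t+2))` (shape (A), even tori `≥ L₀`),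
  give `∫ W̄((t+1) × m) dμ ≤ c` for every `c ≥ 0` with `b₁ b₂ ≤ c²` (`wilsonLoop_integral_limit_le_of_windows_minor`),
  the companion of the monotone transfer `wilsonLoop_integral_limit_le_of_window` already in the tree;
* the instance behind CERTIFIED §E row E8 (`N1-kzL2rphk-LIM-D3-b3-w2x2-upper`): with the referee-signed torus
  windows D1 (`N1-kz-L2-rp-b3-w1x2-upper`, `certs/index.jsonl` row 180) and D2 (`N1-kz-L2-rp-b3-w1x3-upper`, row 182)
  TAKEN AS HYPOTHESES (they are certsdp dual certificates checked by the readers A/B/O, not kernel theorems),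
  `∫ W̄(2 × 2) dμ ≤ 4783792131 / 10¹⁰` for SU(2), `D = 3`, `β_std = 3` (`w2x2_integral_limit_le_of_D1_D2`;
  `(4783792131/10¹⁰)² ≥ b₁ b₂` by `norm_num`) — below the class-LIMIT certificate E8 (`≤ 0.5118125883`), which
  therefore carries no content of its own.

LIMIT POINTS ONLY: the antitone step is false on a fixed torus (wrap-around); on the torus only the minor and the
axis exchange hold (`WilsonLoopRPMinors`). Nothing here is a certificate and no certificate changes.

HONEST FRAMING (page 1 of every file of this cell): certified bounds on lattice expectations at STATED coupling,
gauge group, dimension and torus size; class LIMIT = limit points of even-side torus states along `L → ∞`, NOT a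
finite-torus bound; not a mass gap, not a continuum limit, no uniqueness of the limit claimed, never 'string
tension'; NOT Yang–Mills-summit-bearing (barriers `FixedCouplingUltralocality`, `PerturbativeInvisibility`).
-/

noncomputable section

open MeasureTheory Filter Topology
open Literature.MathematicalPhysics.QuantumFieldTheory
open Literature.MathematicalPhysics.QuantumLattice (LGConfig IsInfiniteVolumeLimitAlong wilsonLoopObs rectWalk
  normalisedCharacter)
open Literature.RepresentationTheory.CompactGroups

namespace Summit.QuantumFields.GaugeBoot

namespace WilsonLoopLimit

variable {D N : ℕ} [NeZero D]

/-- **Axis exchange at a limit point**: `∫ W̄(n × m) dμ = ∫ W̄(m × n) dμ` for the rectangles in the `(0, j)` plane at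
every infinite-volume limit point `μ` of the torus Wilson states (any real coupling, any subsequence of sides): both
sides are limits of the same torus sequence by `wilsonExpectation_wilsonLoop_comm`. [folklore] -/
theorem wilsonLoop_integral_limit_comm {β : ℝ} {Lk : ℕ → ℕ} {μ : Measure (LGConfig D (SU N))}
    (hμ : IsInfiniteVolumeLimitAlong (suRep N) (β / N) Lk μ) {j : Fin D} (hj : j ≠ 0) (n m : ℕ) :
    ∫ U, wilsonLoopObs (normalisedCharacter N ∘ suRep N)
        (rectWalk (0 : Literature.Probability.LatticeModels.Site D) 0 j n m) U ∂μ =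
      ∫ U, wilsonLoopObs (normalisedCharacter N ∘ suRep N)
        (rectWalk (0 : Literature.Probability.LatticeModels.Site D) 0 j m n) U ∂μ := by
  have h1 := tendsto_wilsonExpectation_wilsonLoop hμ j n m
  have h2 := tendsto_wilsonExpectation_wilsonLoop hμ j m n
  exact tendsto_nhds_unique
    (h1.congr fun k => wilsonExpectation_wilsonLoop_comm (continuous_suRep N) (β / (N : ℝ)) hj n m) h2

/-- **Link-minor transfer at a limit point**: for a limit point `μ` of the `SU(N)` torus Wilson states along even
tori at coupling `β/N ≥ 0`, a spatial axis `j ≠ 0`, heights `t`, widths `s ≤ m`: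
`(∫ W̄((t+1) × m) dμ)² ≤ (∫ W̄(t × m) dμ) · (∫ W̄(s × (t+2)) dμ)` — the Hankel minor on the line `m`
(`wilsonLoop_integral_limit_hankel`), the axis exchange `W̄((t+2) × m) = W̄(m × (t+2))`
(`wilsonLoop_integral_limit_comm`) and antitonicity in the first side on the line `t+2`
(`antitone_wilsonLoop_integral_limit`). LIMIT POINTS ONLY. [folklore] -/
theorem wilsonLoop_integral_limit_sq_le_mul {β : ℝ} (hβ : 0 ≤ β) {Lk : ℕ → ℕ} (hmono : StrictMono Lk)
    (heven : ∀ k, Even (Lk k + 1)) {μ : Measure (LGConfig D (SU N))}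
    (hμ : IsInfiniteVolumeLimitAlong (suRep N) (β / N) Lk μ) {j : Fin D} (hj : j ≠ 0)
    (t m : ℕ) {s : ℕ} (hs : s ≤ m) :
    (∫ U, wilsonLoopObs (normalisedCharacter N ∘ suRep N)
        (rectWalk (0 : Literature.Probability.LatticeModels.Site D) 0 j (t + 1) m) U ∂μ) ^ 2 ≤
      (∫ U, wilsonLoopObs (normalisedCharacter N ∘ suRep N)
          (rectWalk (0 : Literature.Probability.LatticeModels.Site D) 0 j t m) U ∂μ) *
        ∫ U, wilsonLoopObs (normalisedCharacter N ∘ suRep N)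
          (rectWalk (0 : Literature.Probability.LatticeModels.Site D) 0 j s (t + 2)) U ∂μ := by
  obtain ⟨h0, -, hc⟩ := wilsonLoop_integral_limit_hankel hβ hmono heven hμ hj m
  have hmin := hc t
  have hsw := wilsonLoop_integral_limit_comm hμ hj (t + 2) m
  have hanti := (antitone_wilsonLoop_integral_limit hβ hmono heven hμ hj (t + 2)).1 hs
  have h0t : 0 ≤ ∫ U, wilsonLoopObs (normalisedCharacter N ∘ suRep N)
      (rectWalk (0 : Literature.Probability.LatticeModels.Site D) 0 j t m) U ∂μ := h0 t
  calc (∫ U, wilsonLoopObs (normalisedCharacter N ∘ suRep N)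
          (rectWalk (0 : Literature.Probability.LatticeModels.Site D) 0 j (t + 1) m) U ∂μ) ^ 2
        ≤ (∫ U, wilsonLoopObs (normalisedCharacter N ∘ suRep N)
            (rectWalk (0 : Literature.Probability.LatticeModels.Site D) 0 j t m) U ∂μ) *
          ∫ U, wilsonLoopObs (normalisedCharacter N ∘ suRep N)
            (rectWalk (0 : Literature.Probability.LatticeModels.Site D) 0 j (t + 2) m) U ∂μ := hmin
    _ = (∫ U, wilsonLoopObs (normalisedCharacter N ∘ suRep N)
            (rectWalk (0 : Literature.Probability.LatticeModels.Site D) 0 j t m) U ∂μ) *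
          ∫ U, wilsonLoopObs (normalisedCharacter N ∘ suRep N)
            (rectWalk (0 : Literature.Probability.LatticeModels.Site D) 0 j m (t + 2)) U ∂μ := by rw [hsw]
    _ ≤ _ := mul_le_mul_of_nonneg_left hanti h0t

/-- **Two certified upper windows bound the next rectangle at every limit point (minor transfer).** If
`W̄(t × m) ≤ b₁` on all even tori `≥ L₁` and `W̄(s × (t+2)) ≤ b₂` on all even tori `≥ L₂` (shape (A) windows of
`Targets`), `s ≤ m`, and `c ≥ 0` with `b₁ b₂ ≤ c²`, then `∫ W̄((t+1) × m) dμ ≤ c` at every infinite-volume limit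
point `μ` of the `SU(N)` torus Wilson states along even tori (coupling `β/N ≥ 0`). Companion of the monotone
transfer `wilsonLoop_integral_limit_le_of_window`; LIMIT POINTS ONLY; exact arithmetic on certified endpoints, no
further solve. [folklore] -/
theorem wilsonLoop_integral_limit_le_of_windows_minor {L₁ L₂ : ℕ} {β a₁ b₁ a₂ b₂ c : ℝ} (hβ : 0 ≤ β)
    {t m s : ℕ} (hs : s ≤ m) (h₁ : WilsonLoopWindow N D L₁ β t m a₁ b₁)
    (h₂ : WilsonLoopWindow N D L₂ β s (t + 2) a₂ b₂) (hc : 0 ≤ c) (hcb : b₁ * b₂ ≤ c ^ 2)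
    {Lk : ℕ → ℕ} (hmono : StrictMono Lk) (heven : ∀ k, Even (Lk k + 1))
    {μ : Measure (LGConfig D (SU N))} (hμ : IsInfiniteVolumeLimitAlong (suRep N) (β / N) Lk μ)
    {j : Fin D} (hj : j ≠ 0) :
    ∫ U, wilsonLoopObs (normalisedCharacter N ∘ suRep N)
        (rectWalk (0 : Literature.Probability.LatticeModels.Site D) 0 j (t + 1) m) U ∂μ ≤ c := by
  have hsq := wilsonLoop_integral_limit_sq_le_mul hβ hmono heven hμ hj t m hs
  obtain ⟨h0m, -, -⟩ := wilsonLoop_integral_limit_hankel hβ hmono heven hμ hj m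
  obtain ⟨h0t, -, -⟩ := wilsonLoop_integral_limit_hankel hβ hmono heven hμ hj (t + 2)
  have hb₁ := (h₁.integral_limit_mem hmono heven hμ 0 hj.symm).2
  have hb₂ := (h₂.integral_limit_mem hmono heven hμ 0 hj.symm).2
  have h0₁ : 0 ≤ ∫ U, wilsonLoopObs (normalisedCharacter N ∘ suRep N)
      (rectWalk (0 : Literature.Probability.LatticeModels.Site D) 0 j t m) U ∂μ := h0m t
  have h0₂ : 0 ≤ ∫ U, wilsonLoopObs (normalisedCharacter N ∘ suRep N)
      (rectWalk (0 : Literature.Probability.LatticeModels.Site D) 0 j s (t + 2)) U ∂μ := h0t s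
  have hprod : (∫ U, wilsonLoopObs (normalisedCharacter N ∘ suRep N)
        (rectWalk (0 : Literature.Probability.LatticeModels.Site D) 0 j t m) U ∂μ) *
      ∫ U, wilsonLoopObs (normalisedCharacter N ∘ suRep N)
        (rectWalk (0 : Literature.Probability.LatticeModels.Site D) 0 j s (t + 2)) U ∂μ ≤ b₁ * b₂ :=
    mul_le_mul hb₁ hb₂ h0₂ (h0₁.trans hb₁)
  have hX : (∫ U, wilsonLoopObs (normalisedCharacter N ∘ suRep N)
      (rectWalk (0 : Literature.Probability.LatticeModels.Site D) 0 j (t + 1) m) U ∂μ) ^ 2 ≤ c ^ 2 :=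
    hsq.trans (hprod.trans hcb)
  exact (abs_le_of_sq_le_sq' hX hc).2

/-- **The instance behind CERTIFIED §E row E8** (SU(2), `D = 3`, `β_std = 3`): taking AS HYPOTHESES the
referee-signed torus-uniform upper windows D1 = `N1-kz-L2-rp-b3-w1x2-upper`
(`W̄(1 × 2) ≤ 28312369776727018042536161 / (45 · 2^80)`, `certs/index.jsonl` row 180) and
D2 = `N1-kz-L2-rp-b3-w1x3-upper` (`W̄(1 × 3) ≤ 4784347408471262491002149 / (9 · 2^80)`, row 182) — certsdp dual
certificates verified by the readers A/B/O, NOT kernel theorems, hence hypotheses —, every infinite-volume limit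
point `μ` of the periodic-torus Wilson states along even sides satisfies `∫ W̄(2 × 2) dμ ≤ 4783792131 / 10^10`
(the outward 10-decimal ceiling of `√(b₁ b₂)`, `b₁ b₂ = 0.22884667…`). The class-LIMIT certificate E8
(`N1-kzL2rphk-LIM-D3-b3-w2x2-upper`, `≤ 0.5118125883`) is weaker by `0.0334333752`. LIMIT POINTS ONLY. [folklore] -/
theorem w2x2_integral_limit_le_of_D1_D2 {L₁ L₂ : ℕ} {a₁ a₂ : ℝ}
    (hD1 : T1W L₁ 3 1 2 a₁ (28312369776727018042536161 / 54401661882658312861777920))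
    (hD2 : T1W L₂ 3 1 3 a₂ (4784347408471262491002149 / 10880332376531662572355584))
    {Lk : ℕ → ℕ} (hmono : StrictMono Lk) (heven : ∀ k, Even (Lk k + 1))
    {μ : Measure (LGConfig 3 (SU 2))} (hμ : IsInfiniteVolumeLimitAlong (suRep 2) ((3 : ℝ) / ((2 : ℕ) : ℝ)) Lk μ)
    {j : Fin 3} (hj : j ≠ 0) :
    ∫ U, wilsonLoopObs (normalisedCharacter 2 ∘ suRep 2)
        (rectWalk (0 : Literature.Probability.LatticeModels.Site 3) 0 j 2 2) U ∂μ ≤ 4783792131 / 10 ^ 10 :=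
  wilsonLoop_integral_limit_le_of_windows_minor (N := 2) (D := 3) (t := 1) (m := 2) (s := 1)
    (by norm_num) (by norm_num) hD1 hD2 (by norm_num) (by norm_num) hmono heven hμ hj

end WilsonLoopLimit

end Summit.QuantumFields.GaugeBoot

end
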